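import Literature.NumberTheory.LFunctions.GuthMaynardZeroSumDecay
import Literature.NumberTheory.LFunctions.ExplicitFormulaPsiProofs
import Literature.NumberTheory.LFunctions.CramerMeanSquareRH
import Literature.NumberTheory.LFunctions.GuthMaynardPrimeCorollaries
import HarnessLib

/-!
# Guth–Maynard §13.2: `ψ(x + y) − ψ(x) = y + O(y e^{−A(log x)^{1/4}})` for `x^{17/30+ε} ≤ y ≤ x` (the `ψ`-form of Corollary 1.3)

NOT RH-BEARING (D-0040; rh-crit cell C4, bears_on LADDER-RH §4 HELD row `DensityLadder`): a
zero-density theorem counts zeros off the critical line, it never empties the strip (Barrier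
`LindelofBacklund`); this file proves a theorem about PRIMES IN SHORT INTERVALS, RH-free literature,
and nothing in it is worded as, or is, progress toward RH.

Topic `Literature/NumberTheory/LFunctions`. THEOREMS only (no definition, no named fact, no `sorry`).
Source: L. Guth, J. Maynard, *New large value estimates for Dirichlet polynomials*, Ann. of Math. (2)
203 (2026) 623–675 = arXiv:2405.20552, **§13.2**, proof of Corollary 1.3:

> "By partial summation, it suffices to prove corresponding results for the Von Mangoldt function in
> place of the prime indicator function. By the explicit formula (see, for example [D]) we have for any
> choice of `2 ≤ T ≤ x`: `∑_{n ∈ [x,x+y]} Λ(n) = y − ∑_{|ρ| ≤ T} ((x+y)^ρ − x^ρ)/ρ + O(x(log x)³/T)`.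
> We choose `T = x y⁻¹ exp(2 (log x)^{1/4})` so the error term is `O(y exp(−(log x)^{1/4}))`, and note
> that the term in parentheses is `∫_x^{x+y} t^{ρ−1} dt ≪ y x^{Re(ρ)−1}`. Therefore … `∑ Λ(n) = y +
> O(y (log x) sup_σ x^{σ−1} N(σ,T)) + O(y exp(−(log x)^{1/4}))` … provided `T < x^{13/30−ε/2}`.
> Recalling that `T = x y⁻¹ exp(2(log x)^{1/4})` and `y ≥ x^{17/30+ε}`, this gives Corollary 1.3."

Contents:
* `GuthMaynard2026.exists_abs_psi_sub_psi_le` — the explicit-formula step: for `x ≥ 2`, `0 < y ≤ x`,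
  `T ≥ 2`, `|ψ(x+y) − ψ(x) − y| ≤ y ∑_{|γ| ≤ T} m(ρ) x^{β−1} + C₀ (log x + (x/T) log²(xT))`, from the
  tree's PROVED truncated explicit formula `truncatedExplicitFormula_psi_holds` (Montgomery–Vaughan
  Thm. 12.5, the tree's form of [D] = Davenport ch. 17), the zero-term bound
  `|((x+y)^ρ − x^ρ)/ρ| ≤ y x^{β−1}` (`Sieve.MontgomeryVaughan1975.norm_cpow_sub_cpow_div_le`, Gallagher
  1970 §5) and `ψ` versus `ψ₀` (`CramerMeanSquare.abs_psi_sub_chebyshevPsi₀_le`).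
* `GuthMaynard2026.psi_shortInterval_of_density` — the conclusion `|ψ(x+y) − ψ(x) − y| ≤
  C y exp(−A(log x)^{1/4})` for `x ≥ x₀(ε, A)`, `x^{17/30+ε} ≤ y ≤ x`, for EVERY real `A` (print:
  `A = 1`; we take `T = x y⁻¹ exp(2A'(log x)^{1/4})`, `A' = max A 1`, the tree's interface
  `GuthMaynard2026_psiShortIntervals` asking for all `A`), under the combined density bound (13.4) as
  hypothesis; the zero sum is `GuthMaynard2026.zeroSum_rpow_decay` (`GuthMaynardZeroSumDecay.lean`).
* `psiShortIntervals_of_combinedDensity`, **`psiShortIntervals_of_nearOne`**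
  (`NearOneZeroDensity → GuthMaynard2026_psiShortIntervals`, the rh-crit WP-C C1 deliverable) and
  `GuthMaynard2026_psiShortIntervals_of_Ivic1985_theorem11_3` — closing the interface
  `GuthMaynard2026_psiShortIntervals` of `GuthMaynardPrimeCorollaries.lean` from, respectively, (13.4),
  the near-one density interface `NearOneZeroDensity`, and Ivić's Theorem 11.3 (the named fact
  `Ivic1985_theorem11_3` of `ZeroDensityNearOne.lean`, the one remaining fact boundary), via the tree's
  `zetaZeroCountRe_le_combined` (Guth–Maynard's `30/13` theorem `zeroDensity_thirty_thirteenths_holds`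
  + the log-power bound near `σ = 1`). The Vinogradov–Korobov input is the tree's inexplicit region
  (standard axioms); no explicit zero-free constant is used.

WHAT THIS IS NOT: not a route, not an RH residual; `π`-form (Cor. 1.3 itself) is the sibling file
`GuthMaynardPrimesShortIntervalsProofs.lean` (partial summation, WP-C C2).

## References

* L. Guth, J. Maynard, *New large value estimates for Dirichlet polynomials*, Ann. of Math. (2) 203
  (2026), no. 2, 623–675; arXiv:2405.20552; §13.2 (chunk p0029 of the held text), Cor. 1.3.
  [GuthMaynard2026]
* H. L. Montgomery, R. C. Vaughan, *Multiplicative Number Theory I*, CUP 2007, Thm. 12.5 (the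
  truncated explicit formula). [MontgomeryVaughan2007]
* H. Davenport, *Multiplicative Number Theory*, 2nd ed., Springer 1980, ch. 17 (GM's [D]).
  [DavenportMNT1980]
* P. X. Gallagher, Invent. Math. 11 (1970), §5 (the zero terms in short intervals). [Gallagher1970]
-/

noncomputable section

open Complex Real Filter Topology Asymptotics Finset
open scoped Chebyshev

namespace Literature.NumberTheory.LFunctions

namespace GuthMaynard2026

/-! ### Two private growth lemmas (copies of the private helpers of `GuthMaynardZeroSumDecay.lean`) -/

/-- Eventually `M + B log u + A u^q ≤ κ u^p` (`q < p`, `0 < p`, `0 < κ`): `log u` and `u^q` are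
`o(u^p)`. [folklore] -/
private theorem eventually_affine_log_rpow_le (M B A : ℝ) {p q κ : ℝ} (hp : 0 < p) (hq : q < p)
    (hκ : 0 < κ) : ∀ᶠ u : ℝ in atTop, M + B * Real.log u + A * u ^ q ≤ κ * u ^ p := by
  have h1 : Tendsto (fun u : ℝ ↦ M / u ^ p) atTop (𝓝 0) :=
    tendsto_const_nhds.div_atTop (tendsto_rpow_atTop hp)
  have h2 : Tendsto (fun u : ℝ ↦ B * Real.log u / u ^ p) atTop (𝓝 0) :=
    ((isLittleO_log_rpow_atTop hp).const_mul_left B).tendsto_div_nhds_zero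
  have h3 : Tendsto (fun u : ℝ ↦ A * u ^ q / u ^ p) atTop (𝓝 0) := by
    have h := (tendsto_rpow_neg_atTop (by linarith : 0 < p - q)).const_mul A
    rw [mul_zero] at h
    refine h.congr' ?_
    filter_upwards [eventually_gt_atTop (0 : ℝ)] with u hu
    rw [neg_sub, Real.rpow_sub hu, mul_div_assoc]
  have hsum : Tendsto (fun u : ℝ ↦ (M + B * Real.log u + A * u ^ q) / u ^ p) atTop (𝓝 0) := by
    have := (h1.add h2).add h3
    simp only [add_zero] at this
    refine this.congr' (Eventually.of_forall fun u ↦ ?_)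
    simp only
    ring
  filter_upwards [(tendsto_order.1 hsum).2 κ hκ, eventually_gt_atTop (0 : ℝ)] with u hu hu0
  have hp0 : 0 < u ^ p := Real.rpow_pos_of_pos hu0 _
  exact ((div_lt_iff₀ hp0).1 hu).le

/-- `K u^B e^L ≤ e^R` from `log K + B log u + L ≤ R` (`K, u > 0`). [folklore] -/
private theorem mul_rpow_mul_exp_le_exp {K u B L R : ℝ} (hK : 0 < K) (hu : 0 < u)
    (h : Real.log K + B * Real.log u + L ≤ R) : K * u ^ B * Real.exp L ≤ Real.exp R := by
  have : Real.exp (Real.log K + B * Real.log u + L) = K * u ^ B * Real.exp L := by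
    rw [Real.exp_add, Real.exp_add, Real.exp_log hK, Real.rpow_def_of_pos hu, mul_comm (Real.log u)]
  rw [← this]
  exact Real.exp_le_exp.2 h

/-! ### The explicit formula, differenced -/

/-- **The explicit-formula step of §13.2** (Guth–Maynard, proof of Cor. 1.3, from [D] = Davenport
ch. 17; here from Montgomery–Vaughan Thm. 12.5 = the tree's `truncatedExplicitFormula_psi_holds`):
for `x ≥ 2`, `0 < y ≤ x`, `T ≥ 2`,
`|ψ(x+y) − ψ(x) − y| ≤ y ∑_{|γ| ≤ T} m(ρ) x^{β−1} + C₀ (log x + (x/T) log²(xT))`.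
The zero terms are `((x+y)^ρ − x^ρ)/ρ = ∫_x^{x+y} t^{ρ−1} dt ≪ y x^{β−1}`
(`Sieve.MontgomeryVaughan1975.norm_cpow_sub_cpow_div_le`, Gallagher 1970 §5); `ψ` versus `ψ₀`
costs `(log u)/2` (`CramerMeanSquare.abs_psi_sub_chebyshevPsi₀_le`); the terms `log 2π` cancel and
`|½ log(1 − u⁻²)| ≤ 1`. [cite: GuthMaynard2026, §13.2] [cite: MontgomeryVaughan2007, Thm. 12.5] -/
theorem exists_abs_psi_sub_psi_le :
    ∃ C₀ : ℝ, 0 < C₀ ∧ ∀ x : ℝ, 2 ≤ x → ∀ y : ℝ, 0 < y → y ≤ x → ∀ T : ℝ, 2 ≤ T →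
      |ψ (x + y) - ψ x - y| ≤
        y * ∑ ρ ∈ (weilZeroIndex_finite T).toFinset,
            (riemannZetaZeroOrder ρ : ℝ) * x ^ (ρ.re - 1) +
          C₀ * (Real.log x + x / T * Real.log (x * T) ^ 2) := by
  classical
  obtain ⟨C, hC⟩ := truncatedExplicitFormula_psi_holds 2 (by norm_num)
  set C' := max C 0 with hC'
  have hC'0 : 0 ≤ C' := le_max_right _ _
  refine ⟨5 + 9 * C', by positivity, fun x hx y hy hyx T hT ↦ ?_⟩
  have hx0 : 0 < x := by linarith
  have hx1 : 1 ≤ x := by linarith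
  have hT0 : 0 < T := by linarith
  have hxy2 : 2 ≤ x + y := by linarith
  have hxy1 : 1 ≤ x + y := by linarith
  have hxy : x + y ≤ 2 * x := by linarith
  set s := (weilZeroIndex_finite T).toFinset with hs
  set Zsum : ℝ := ∑ ρ ∈ s, (riemannZetaZeroOrder ρ : ℝ) * x ^ (ρ.re - 1) with hZsum
  -- logarithms
  have hlog2 : (2 : ℝ) / 3 < Real.log 2 := lt_trans (by norm_num) Real.log_two_gt_d9
  have hlogx2 : Real.log 2 ≤ Real.log x := Real.log_le_log (by norm_num) hx
  have hlogx0 : 0 < Real.log x := lt_of_lt_of_le (by linarith) hlogx2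
  have hlog2x : Real.log (2 * x) ≤ 2 * Real.log x := by
    rw [Real.log_mul (by norm_num) hx0.ne']; linarith
  have hlogxy : Real.log (x + y) ≤ 2 * Real.log x := (Real.log_le_log (by linarith) hxy).trans hlog2x
  have hlogxy0 : 0 ≤ Real.log (x + y) := Real.log_nonneg hxy1
  have hxT4 : 4 ≤ x * T := by nlinarith
  have hlogxT0 : 0 ≤ Real.log (x * T) := Real.log_nonneg (by linarith)
  have hlogxyT : Real.log ((x + y) * T) ≤ 2 * Real.log (x * T) := by
    have h1 : (x + y) * T ≤ (x * T) * (x * T) := by nlinarith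
    calc Real.log ((x + y) * T) ≤ Real.log ((x * T) * (x * T)) :=
          Real.log_le_log (by positivity) h1
      _ = 2 * Real.log (x * T) := by rw [Real.log_mul (by positivity) (by positivity)]; ring
  have hlogxyT0 : 0 ≤ Real.log ((x + y) * T) := Real.log_nonneg (by nlinarith)
  -- the remainder `R(u, T)` of MV (12.3) at `u = x` and `u = x + y`
  have hRem : ∀ u : ℝ, 2 ≤ u →
      C * (Real.log u * min 1 (u / (T * primePowDist u)) + u / T * Real.log (u * T) ^ 2) ≤
        C' * (Real.log u + u / T * Real.log (u * T) ^ 2) := by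
    intro u hu
    have hu0 : 0 < u := by linarith
    have hlu : 0 ≤ Real.log u := Real.log_nonneg (by linarith)
    have hmin0 : 0 ≤ min 1 (u / (T * primePowDist u)) :=
      le_min zero_le_one (div_nonneg hu0.le (mul_nonneg hT0.le (primePowDist_nonneg u)))
    have hA0 : 0 ≤ Real.log u * min 1 (u / (T * primePowDist u)) + u / T * Real.log (u * T) ^ 2 := by
      positivity
    calc C * (Real.log u * min 1 (u / (T * primePowDist u)) + u / T * Real.log (u * T) ^ 2)
        ≤ C' * (Real.log u * min 1 (u / (T * primePowDist u)) + u / T * Real.log (u * T) ^ 2) :=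
          mul_le_mul_of_nonneg_right (le_max_left _ _) hA0
      _ ≤ C' * (Real.log u * 1 + u / T * Real.log (u * T) ^ 2) := by gcongr; exact min_le_left _ _
      _ = C' * (Real.log u + u / T * Real.log (u * T) ^ 2) := by ring
  -- `|½ log(1 − 1/u²)| ≤ 1` for `u ≥ 2`
  have hg : ∀ u : ℝ, 2 ≤ u → |1 / 2 * Real.log (1 - 1 / u ^ 2)| ≤ 1 := by
    intro u hu
    have hy0 : 3 / 4 ≤ 1 - 1 / u ^ 2 := by
      have : 1 / u ^ 2 ≤ 1 / 4 := by
        rw [div_le_div_iff₀ (by positivity) (by norm_num)]; nlinarith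
      linarith
    have hy1 : 1 - 1 / u ^ 2 ≤ 1 := by
      have : 0 ≤ 1 / u ^ 2 := by positivity
      linarith
    have hlo := Real.one_sub_inv_le_log_of_pos (by linarith : (0 : ℝ) < 1 - 1 / u ^ 2)
    have hhi := Real.log_nonpos (by linarith) hy1
    have : (1 - 1 / u ^ 2)⁻¹ ≤ 4 / 3 := by
      rw [inv_eq_one_div, div_le_div_iff₀ (by linarith) (by norm_num)]; linarith
    rw [abs_le]; constructor <;> linarith
  -- the zero terms: `‖S(x+y) − S(x)‖ ≤ y Zsum`
  have hS : ‖zetaZeroSumTrunc (x + y) T - zetaZeroSumTrunc x T‖ ≤ y * Zsum := by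
    have hdiff : zetaZeroSumTrunc (x + y) T - zetaZeroSumTrunc x T =
        ∑ ρ ∈ s, (riemannZetaZeroOrder ρ : ℂ) *
          ((((x + y : ℝ) : ℂ) ^ ρ - (x : ℂ) ^ ρ) / ρ) := by
      rw [zetaZeroSumTrunc, zetaZeroSumTrunc, ← hs, ← Finset.sum_sub_distrib]
      refine Finset.sum_congr rfl fun ρ _ ↦ ?_
      rw [sub_div]; ring
    rw [hdiff, hZsum, Finset.mul_sum]
    refine (norm_sum_le _ _).trans (Finset.sum_le_sum fun ρ hρ ↦ ?_)
    have hmem : ρ ∈ weilZeroIndex T := by rw [hs, Set.Finite.mem_toFinset] at hρ; exact hρ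
    have hρ0 : ρ ≠ 0 := ne_zero_of_mem_weilZeroIndex hmem
    have hre : ρ.re ≤ 1 := hmem.2.2.1
    have hm0 : (0 : ℝ) ≤ riemannZetaZeroOrder ρ := riemannZetaZeroOrder_nonneg_of_zero hmem.1
    have hterm := Literature.NumberTheory.Sieve.MontgomeryVaughan1975.norm_cpow_sub_cpow_div_le
      hx0 (by linarith : x ≤ x + y) hρ0 hre
    rw [norm_mul, Complex.norm_intCast, abs_of_nonneg hm0]
    calc (riemannZetaZeroOrder ρ : ℝ) * ‖((((x + y : ℝ) : ℂ)) ^ ρ - (x : ℂ) ^ ρ) / ρ‖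
        ≤ (riemannZetaZeroOrder ρ : ℝ) * ((x + y - x) * x ^ (ρ.re - 1)) :=
          mul_le_mul_of_nonneg_left hterm hm0
      _ = y * ((riemannZetaZeroOrder ρ : ℝ) * x ^ (ρ.re - 1)) := by ring
  -- the explicit formula at `x` and at `x + y`
  have hEx := (hC x hx T hT).trans (hRem x hx)
  have hExy := (hC (x + y) hxy2 T hT).trans (hRem (x + y) hxy2)
  set Ax := (chebyshevPsi₀ x : ℂ) - ((x : ℂ) - zetaZeroSumTrunc x T - (Real.log (2 * π) : ℂ)
      - ((1 / 2 * Real.log (1 - 1 / x ^ 2) : ℝ) : ℂ)) with hAx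
  set Axy := (chebyshevPsi₀ (x + y) : ℂ) - (((x + y : ℝ) : ℂ) - zetaZeroSumTrunc (x + y) T
      - (Real.log (2 * π) : ℂ) - ((1 / 2 * Real.log (1 - 1 / (x + y) ^ 2) : ℝ) : ℂ)) with hAxy
  have hAx_le : ‖Ax‖ ≤ C' * (Real.log x + x / T * Real.log (x * T) ^ 2) := by
    refine le_trans (le_of_eq ?_) hEx
    rw [hAx]; congr 1; push_cast; ring
  have hAxy_le : ‖Axy‖ ≤ C' * (Real.log (x + y) + (x + y) / T * Real.log ((x + y) * T) ^ 2) := by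
    refine le_trans (le_of_eq ?_) hExy
    rw [hAxy]; congr 1; push_cast; ring
  -- the identity for `ψ₀(x+y) − ψ₀(x) − y`
  set gx := ((1 / 2 * Real.log (1 - 1 / x ^ 2) : ℝ) : ℂ) with hgx
  set gxy := ((1 / 2 * Real.log (1 - 1 / (x + y) ^ 2) : ℝ) : ℂ) with hgxy
  have hid : ((chebyshevPsi₀ (x + y) - chebyshevPsi₀ x - y : ℝ) : ℂ) =
      Axy - Ax - (zetaZeroSumTrunc (x + y) T - zetaZeroSumTrunc x T) - (gxy - gx) := by
    rw [hAxy, hAx]; push_cast; ring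
  have hψ0 : |chebyshevPsi₀ (x + y) - chebyshevPsi₀ x - y| ≤
      ‖Axy‖ + ‖Ax‖ + y * Zsum + 2 := by
    have hn : |chebyshevPsi₀ (x + y) - chebyshevPsi₀ x - y| =
        ‖((chebyshevPsi₀ (x + y) - chebyshevPsi₀ x - y : ℝ) : ℂ)‖ := by
      rw [Complex.norm_real, Real.norm_eq_abs]
    rw [hn, hid]
    have hgxn : ‖gx‖ ≤ 1 := by rw [hgx, Complex.norm_real, Real.norm_eq_abs]; exact hg x hx
    have hgxyn : ‖gxy‖ ≤ 1 := by rw [hgxy, Complex.norm_real, Real.norm_eq_abs]; exact hg (x + y) hxy2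
    calc ‖Axy - Ax - (zetaZeroSumTrunc (x + y) T - zetaZeroSumTrunc x T) - (gxy - gx)‖
        ≤ ‖Axy - Ax - (zetaZeroSumTrunc (x + y) T - zetaZeroSumTrunc x T)‖ + ‖gxy - gx‖ :=
          norm_sub_le _ _
      _ ≤ ‖Axy - Ax‖ + ‖zetaZeroSumTrunc (x + y) T - zetaZeroSumTrunc x T‖ + (‖gxy‖ + ‖gx‖) := by
          gcongr
          · exact norm_sub_le _ _
          · exact norm_sub_le _ _
      _ ≤ ‖Axy‖ + ‖Ax‖ + y * Zsum + (1 + 1) := by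
          gcongr
          exact norm_sub_le _ _
      _ = ‖Axy‖ + ‖Ax‖ + y * Zsum + 2 := by ring
  -- `ψ` versus `ψ₀`
  have h1 := CramerMeanSquare.abs_psi_sub_chebyshevPsi₀_le hx1
  have h2 := CramerMeanSquare.abs_psi_sub_chebyshevPsi₀_le hxy1
  have htri : |ψ (x + y) - ψ x - y| ≤ |ψ (x + y) - chebyshevPsi₀ (x + y)| + |ψ x - chebyshevPsi₀ x| +
      |chebyshevPsi₀ (x + y) - chebyshevPsi₀ x - y| := by
    have e : ψ (x + y) - ψ x - y = (ψ (x + y) - chebyshevPsi₀ (x + y)) - (ψ x - chebyshevPsi₀ x) +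
        (chebyshevPsi₀ (x + y) - chebyshevPsi₀ x - y) := by ring
    rw [e]
    refine (abs_add_le _ _).trans ?_
    gcongr
    exact abs_sub _ _
  -- collect
  have hZsum0 : 0 ≤ Zsum := Finset.sum_nonneg fun ρ hρ ↦ by
    have hmem : ρ ∈ weilZeroIndex T := by rw [hs, Set.Finite.mem_toFinset] at hρ; exact hρ
    exact mul_nonneg (riemannZetaZeroOrder_nonneg_of_zero hmem.1) (Real.rpow_nonneg hx0.le _)
  have hmainx : 0 ≤ x / T * Real.log (x * T) ^ 2 := by positivity
  have hxyT : (x + y) / T * Real.log ((x + y) * T) ^ 2 ≤ 8 * (x / T * Real.log (x * T) ^ 2) := by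
    have h3 : (x + y) / T ≤ 2 * (x / T) := by
      rw [div_le_iff₀ hT0]; field_simp; linarith
    have h4 : Real.log ((x + y) * T) ^ 2 ≤ (2 * Real.log (x * T)) ^ 2 :=
      pow_le_pow_left₀ hlogxyT0 hlogxyT 2
    calc (x + y) / T * Real.log ((x + y) * T) ^ 2 ≤ 2 * (x / T) * (2 * Real.log (x * T)) ^ 2 :=
          mul_le_mul h3 h4 (sq_nonneg _) (by positivity)
      _ = 8 * (x / T * Real.log (x * T) ^ 2) := by ring
  calc |ψ (x + y) - ψ x - y|
      ≤ |ψ (x + y) - chebyshevPsi₀ (x + y)| + |ψ x - chebyshevPsi₀ x| +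
          |chebyshevPsi₀ (x + y) - chebyshevPsi₀ x - y| := htri
    _ ≤ Real.log (x + y) / 2 + Real.log x / 2 + (‖Axy‖ + ‖Ax‖ + y * Zsum + 2) := by gcongr
    _ ≤ 2 * Real.log x / 2 + Real.log x / 2 +
          (C' * (Real.log (x + y) + (x + y) / T * Real.log ((x + y) * T) ^ 2) +
            C' * (Real.log x + x / T * Real.log (x * T) ^ 2) + y * Zsum + 2) := by gcongr
    _ ≤ 2 * Real.log x / 2 + Real.log x / 2 +
          (C' * (2 * Real.log x + 8 * (x / T * Real.log (x * T) ^ 2)) +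
            C' * (Real.log x + x / T * Real.log (x * T) ^ 2) + y * Zsum + 3 * Real.log x) := by
          gcongr
          linarith
    _ = y * Zsum + ((9 / 2) * Real.log x + 9 * C' * (x / T * Real.log (x * T) ^ 2) +
          3 * C' * Real.log x) := by ring
    _ ≤ y * Zsum + (5 + 9 * C') * (Real.log x + x / T * Real.log (x * T) ^ 2) := by
          nlinarith

/-! ### The prime number theorem in short intervals `y ≥ x^{17/30+ε}` for `ψ` -/

/-- **`ψ(x+y) − ψ(x) = y + O_{ε,A}(y exp(−A(log x)^{1/4}))` for `x^{17/30+ε} ≤ y ≤ x`, from the combined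
zero-density bound** — Guth–Maynard, Ann. of Math. 203 (2026), §13.2, the `ψ`-form of Corollary 1.3
("By partial summation, it suffices to prove corresponding results for the Von Mangoldt function").
Hypothesis: the combined density estimate (13.4) `N(σ,T) ≤ C T^{(30/13+η)(1−σ)} (log T)^B` on
`[1/2, 1]` for every `η > 0` (the tree's `zetaZeroCountRe_le_combined`). Proof as printed: the
explicit formula (`exists_abs_psi_sub_psi_le`) with `T = x y⁻¹ exp(2A'(log x)^{1/4})`,
`A' = max A 1` (print: `A = 1`), the zero sum bounded by `zeroSum_rpow_decay` (valid as
`T ≤ x^{13/30 − ε'/2}`, `ε' = min ε (1/10)`), and the error `x(log x)²/T = y e^{−2A'(log x)^{1/4}}(log x)²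
≪ y e^{−A'(log x)^{1/4}}`. The range `y ≤ x` contains the printed `y ≤ x^{0.99}`. A theorem about
primes; RH-free. [cite: GuthMaynard2026, §13.2 (proof of Corollary 1.3)] -/
theorem psi_shortInterval_of_density
    (hcomb : ∀ η : ℝ, 0 < η → ∃ C B T₀ : ℝ, ∀ T : ℝ, T₀ ≤ T → ∀ σ : ℝ, 1 / 2 ≤ σ → σ ≤ 1 →
      (zetaZeroCountRe σ T : ℝ) ≤ C * T ^ ((30 / 13 + η) * (1 - σ)) * Real.log T ^ B)
    {ε : ℝ} (hε : 0 < ε) (A : ℝ) :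
    ∃ C x₀ : ℝ, ∀ x : ℝ, x₀ ≤ x → ∀ y : ℝ, x ^ (17 / 30 + ε) ≤ y → y ≤ x →
      |ψ (x + y) - ψ x - y| ≤ C * y * Real.exp (-A * (Real.log x) ^ (1 / 4 : ℝ)) := by
  obtain ⟨C₀, hC₀, hEF⟩ := exists_abs_psi_sub_psi_le
  set A' : ℝ := max A 1 with hA'
  have hA'1 : 1 ≤ A' := le_max_right _ _
  have hA'0 : 0 < A' := by linarith
  have hAA' : A ≤ A' := le_max_left _ _
  set ε' : ℝ := min ε (1 / 10) with hε'
  have hε'0 : 0 < ε' := lt_min hε (by norm_num)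
  have hε'1 : ε' ≤ 1 / 10 := min_le_right _ _
  have hε'ε : ε' ≤ ε := min_le_left _ _
  obtain ⟨Cz, Z₀, hZ⟩ := zeroSum_rpow_decay hcomb (ε := ε' / 2) (by positivity) A'
  -- eventual conditions in `u = log x`
  have ha := eventually_affine_log_rpow_le 0 0 A' (p := 1) (q := 1 / 4) (κ := ε' / 4)
    one_pos (by norm_num) (by positivity)
  have hb := eventually_affine_log_rpow_le (Real.log (2 * C₀)) 1 A' (p := 1) (q := 1 / 4)
    (κ := 1 / 2) one_pos (by norm_num) (by norm_num)
  have hc := eventually_affine_log_rpow_le (Real.log (32 * C₀)) 2 1 (p := 1 / 4) (q := 0)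
    (κ := A') (by norm_num) (by norm_num) hA'0
  obtain ⟨x₀, hx₀⟩ := ((Real.tendsto_log_atTop.eventually (ha.and (hb.and (hc.and
    (eventually_ge_atTop (1 : ℝ)))))).and
    ((eventually_ge_atTop Z₀).and (eventually_ge_atTop (2 : ℝ)))).exists_forall_of_atTop
  refine ⟨max Cz 0 + 1, x₀, fun x hx y hyl hyu ↦ ?_⟩
  obtain ⟨⟨hau, hbu, hcu, hu1⟩, hxZ₀, hx2⟩ := hx₀ x hx
  have hx0 : 0 < x := by linarith
  have hx1 : 1 < x := by linarith
  set u : ℝ := Real.log x with hu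
  have hu0 : 0 < u := Real.log_pos hx1
  have hy0 : 0 < y := lt_of_lt_of_le (Real.rpow_pos_of_pos hx0 _) hyl
  -- the parameter `T = x y⁻¹ exp(2A' (log x)^{1/4})`
  set E : ℝ := Real.exp (2 * A' * u ^ (1 / 4 : ℝ)) with hE
  have hE0 : 0 < E := Real.exp_pos _
  set T : ℝ := x / y * E with hT
  have hT0 : 0 < T := by positivity
  have hET : E ≤ T := by
    rw [hT]
    have : 1 ≤ x / y := by rw [le_div_iff₀ hy0]; linarith
    nlinarith
  have hu14 : 1 ≤ u ^ (1 / 4 : ℝ) := Real.one_le_rpow hu1 (by norm_num)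
  have hE2 : 2 ≤ E := by
    rw [hE]
    have h2 : (2 : ℝ) ≤ 2 * A' * u ^ (1 / 4 : ℝ) := by nlinarith
    linarith [Real.add_one_le_exp (2 * A' * u ^ (1 / 4 : ℝ))]
  have hT2 : 2 ≤ T := hE2.trans hET
  -- `T ≤ x^{13/30 − ε'/2} ≤ x`
  have hEle : E ≤ x ^ (ε' / 2) := by
    rw [hE, Real.rpow_def_of_pos hx0, ← hu]
    refine Real.exp_le_exp.2 ?_
    have h4 : (0 : ℝ) + 0 * Real.log u + A' * u ^ (1 / 4 : ℝ) ≤ ε' / 4 * u ^ (1 : ℝ) := hau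
    simp only [Real.rpow_one, zero_mul, zero_add] at h4
    have h5 : 2 * (A' * u ^ (1 / 4 : ℝ)) ≤ 2 * (ε' / 4 * u) :=
      mul_le_mul_of_nonneg_left h4 (by norm_num)
    calc 2 * A' * u ^ (1 / 4 : ℝ) = 2 * (A' * u ^ (1 / 4 : ℝ)) := by ring
      _ ≤ 2 * (ε' / 4 * u) := h5
      _ = u * (ε' / 2) := by ring
  have hTup : T ≤ x ^ (13 / 30 - ε' / 2) := by
    have h1 : x / y ≤ x ^ (13 / 30 - ε') := by
      rw [div_le_iff₀ hy0]
      have h2 : x ^ (13 / 30 - ε') * x ^ (17 / 30 + ε) ≤ x ^ (13 / 30 - ε') * y :=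
        mul_le_mul_of_nonneg_left hyl (Real.rpow_nonneg hx0.le _)
      refine le_trans ?_ h2
      rw [← Real.rpow_add hx0]
      conv_lhs => rw [← Real.rpow_one x]
      exact Real.rpow_le_rpow_of_exponent_le hx1.le (by linarith)
    calc T = x / y * E := rfl
      _ ≤ x ^ (13 / 30 - ε') * x ^ (ε' / 2) :=
          mul_le_mul h1 hEle hE0.le (Real.rpow_nonneg hx0.le _)
      _ = x ^ (13 / 30 - ε' / 2) := by rw [← Real.rpow_add hx0]; ring_nf
  have hTx : T ≤ x := hTup.trans (by
    conv_rhs => rw [← Real.rpow_one x]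
    exact Real.rpow_le_rpow_of_exponent_le hx1.le (by linarith))
  -- the two inputs
  have hZx := hZ x hxZ₀ T hTup
  have hEFx := hEF x hx2 y hy0 hyu T hT2
  -- the error terms
  have hexp0 : 0 < Real.exp (-(A' * u ^ (1 / 4 : ℝ))) := Real.exp_pos _
  have herr1 : C₀ * Real.log x ≤ y * Real.exp (-(A' * u ^ (1 / 4 : ℝ))) / 2 := by
    -- `2 C₀ u e^{A' u^{1/4}} ≤ e^{u/2} = x^{1/2} ≤ y`
    have h := mul_rpow_mul_exp_le_exp (by positivity : (0 : ℝ) < 2 * C₀) hu0 hbu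
    rw [Real.rpow_one] at h
    have hsqrt : Real.exp (1 / 2 * u) ≤ y := by
      have : Real.exp (1 / 2 * u) = x ^ (1 / 2 : ℝ) := by
        rw [Real.rpow_def_of_pos hx0, ← hu, mul_comm]
      rw [this]
      exact (Real.rpow_le_rpow_of_exponent_le hx1.le (by linarith)).trans hyl
    have e1 : C₀ * Real.log x = (2 * C₀ * u * Real.exp (A' * u ^ (1 / 4 : ℝ))) *
        Real.exp (-(A' * u ^ (1 / 4 : ℝ))) / 2 := by
      rw [← hu]
      have : Real.exp (A' * u ^ (1 / 4 : ℝ)) * Real.exp (-(A' * u ^ (1 / 4 : ℝ))) = 1 := by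
        rw [← Real.exp_add, add_neg_cancel, Real.exp_zero]
      calc C₀ * u = C₀ * u * (Real.exp (A' * u ^ (1 / 4 : ℝ)) *
          Real.exp (-(A' * u ^ (1 / 4 : ℝ)))) := by rw [this, mul_one]
        _ = _ := by ring
    rw [e1]
    have := mul_le_mul_of_nonneg_right (h.trans hsqrt) hexp0.le
    linarith
  have herr2 : C₀ * (x / T * Real.log (x * T) ^ 2) ≤ y * Real.exp (-(A' * u ^ (1 / 4 : ℝ))) / 2 := by
    have hxT : x / T = y * Real.exp (-(2 * A' * u ^ (1 / 4 : ℝ))) := by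
      rw [hT, hE, Real.exp_neg]
      field_simp
    have hlogxT : Real.log (x * T) ≤ 2 * u := by
      calc Real.log (x * T) ≤ Real.log (x * x) :=
            Real.log_le_log (by positivity) (mul_le_mul_of_nonneg_left hTx hx0.le)
        _ = 2 * u := by rw [Real.log_mul hx0.ne' hx0.ne', ← hu]; ring
    have hlogxT0 : 0 ≤ Real.log (x * T) := Real.log_nonneg (by nlinarith)
    have hsq : Real.log (x * T) ^ 2 ≤ (2 * u) ^ 2 := pow_le_pow_left₀ hlogxT0 hlogxT 2
    -- `32 C₀ u² e ≤ e^{A' u^{1/4}}`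
    have h := mul_rpow_mul_exp_le_exp (by positivity : (0 : ℝ) < 32 * C₀) hu0 hcu
    rw [Real.rpow_zero, mul_one, show (2 : ℝ) = ((2 : ℕ) : ℝ) by norm_num, Real.rpow_natCast] at h
    have he1 : 1 ≤ Real.exp 1 := Real.one_le_exp (by norm_num)
    have h8 : 8 * C₀ * u ^ 2 ≤ Real.exp (A' * u ^ (1 / 4 : ℝ)) := by
      have h0 : 0 ≤ C₀ * u ^ 2 := by positivity
      have := mul_le_mul_of_nonneg_left he1 h0
      linarith
    calc C₀ * (x / T * Real.log (x * T) ^ 2)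
        ≤ C₀ * (y * Real.exp (-(2 * A' * u ^ (1 / 4 : ℝ))) * (2 * u) ^ 2) := by
          rw [hxT]; gcongr
      _ = (8 * C₀ * u ^ 2) * Real.exp (-(2 * A' * u ^ (1 / 4 : ℝ))) * y / 2 := by ring
      _ ≤ Real.exp (A' * u ^ (1 / 4 : ℝ)) * Real.exp (-(2 * A' * u ^ (1 / 4 : ℝ))) * y / 2 := by
          gcongr
      _ = y * Real.exp (-(A' * u ^ (1 / 4 : ℝ))) / 2 := by
          rw [← Real.exp_add]; ring_nf
  -- assemble
  have hZsum0 : 0 ≤ ∑ ρ ∈ (weilZeroIndex_finite T).toFinset,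
      (riemannZetaZeroOrder ρ : ℝ) * x ^ (ρ.re - 1) :=
    Finset.sum_nonneg fun ρ hρ ↦ by
      have hmem : ρ ∈ weilZeroIndex T := (Set.Finite.mem_toFinset _).1 hρ
      exact mul_nonneg (riemannZetaZeroOrder_nonneg_of_zero hmem.1) (Real.rpow_nonneg hx0.le _)
  have hZx' : ∑ ρ ∈ (weilZeroIndex_finite T).toFinset,
      (riemannZetaZeroOrder ρ : ℝ) * x ^ (ρ.re - 1) ≤ max Cz 0 * Real.exp (-(A' * u ^ (1 / 4 : ℝ))) := by
    refine hZx.trans ?_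
    rw [neg_mul, ← hu]
    exact mul_le_mul_of_nonneg_right (le_max_left _ _) hexp0.le
  have hmonoA : Real.exp (-(A' * u ^ (1 / 4 : ℝ))) ≤ Real.exp (-A * Real.log x ^ (1 / 4 : ℝ)) := by
    rw [← hu, neg_mul]
    refine Real.exp_le_exp.2 (neg_le_neg ?_)
    exact mul_le_mul_of_nonneg_right hAA' (by positivity)
  calc |ψ (x + y) - ψ x - y|
      ≤ y * ∑ ρ ∈ (weilZeroIndex_finite T).toFinset,
            (riemannZetaZeroOrder ρ : ℝ) * x ^ (ρ.re - 1) +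
          C₀ * (Real.log x + x / T * Real.log (x * T) ^ 2) := hEFx
    _ ≤ y * (max Cz 0 * Real.exp (-(A' * u ^ (1 / 4 : ℝ)))) +
          (y * Real.exp (-(A' * u ^ (1 / 4 : ℝ))) / 2 + y * Real.exp (-(A' * u ^ (1 / 4 : ℝ))) / 2) := by
          rw [mul_add]
          gcongr
    _ = (max Cz 0 + 1) * y * Real.exp (-(A' * u ^ (1 / 4 : ℝ))) := by ring
    _ ≤ (max Cz 0 + 1) * y * Real.exp (-A * Real.log x ^ (1 / 4 : ℝ)) := by
          gcongr

end GuthMaynard2026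

/-! ### Closing the interface of `GuthMaynardPrimeCorollaries.lean` -/

/-- **Guth–Maynard §13.2, `ψ` in short intervals, from the combined density bound (13.4)**:
the tree's interface `GuthMaynard2026_psiShortIntervals` (`GuthMaynardPrimeCorollaries.lean`:
`∀ ε > 0, ∀ A, ∃ C x₀, ∀ x ≥ x₀, ∀ y ∈ [x^{17/30+ε}, x^{0.99}], |ψ(x+y) − ψ(x) − y| ≤ C y e^{−A(log x)^{1/4}}`)
follows from `GuthMaynard2026.psi_shortInterval_of_density` (range `y ≤ x ⊇ y ≤ x^{0.99}`).
[cite: GuthMaynard2026, §13.2 (proof of Corollary 1.3)] -/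
theorem psiShortIntervals_of_combinedDensity
    (hcomb : ∀ η : ℝ, 0 < η → ∃ C B T₀ : ℝ, ∀ T : ℝ, T₀ ≤ T → ∀ σ : ℝ, 1 / 2 ≤ σ → σ ≤ 1 →
      (zetaZeroCountRe σ T : ℝ) ≤ C * T ^ ((30 / 13 + η) * (1 - σ)) * Real.log T ^ B) :
    GuthMaynard2026_psiShortIntervals := by
  intro ε hε A
  obtain ⟨C, x₀, h⟩ := GuthMaynard2026.psi_shortInterval_of_density hcomb hε A
  refine ⟨C, max x₀ 1, fun x hx y hyl hyu ↦ h x ((le_max_left _ _).trans hx) y hyl (hyu.trans ?_)⟩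
  have hx1 : 1 ≤ x := (le_max_right _ _).trans hx
  conv_rhs => rw [← Real.rpow_one x]
  exact Real.rpow_le_rpow_of_exponent_le hx1 (by norm_num)

/-- **`NearOneZeroDensity → GuthMaynard2026_psiShortIntervals`** (the WP-C C1 deliverable of the
rh-crit/gm cell): Guth–Maynard's `ψ`-form of Corollary 1.3 from the near-`σ = 1` density interface
`NearOneZeroDensity` of `ZeroDensityNearOne.lean`, via its `zetaZeroCountRe_le_combined` (which combines
it with the `30/13` density theorem `zeroDensity_thirty_thirteenths_holds`).
[cite: GuthMaynard2026, §13.2 (proof of Corollary 1.3)] -/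
theorem psiShortIntervals_of_nearOne (h : NearOneZeroDensity) : GuthMaynard2026_psiShortIntervals :=
  psiShortIntervals_of_combinedDensity fun η hη ↦ by
    obtain ⟨C, B, T₀, -, h'⟩ := zetaZeroCountRe_le_combined h η hη
    exact ⟨C, B, T₀, h'⟩

/-- **`GuthMaynard2026_psiShortIntervals` from Ivić's Theorem 11.3** (the named fact
`Ivic1985_theorem11_3` of `ZeroDensityNearOne.lean`, the one remaining fact boundary of Cor. 1.3),
via `zetaZeroCountRe_le_combined_of_Ivic1985_theorem11_3`. [cite: GuthMaynard2026, §13.2]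
[cite: Ivic1985, Theorem 11.3] -/
theorem GuthMaynard2026_psiShortIntervals_of_Ivic1985_theorem11_3 (h : Ivic1985_theorem11_3) :
    GuthMaynard2026_psiShortIntervals :=
  psiShortIntervals_of_combinedDensity fun η hη ↦ by
    obtain ⟨C, B, T₀, -, h'⟩ := zetaZeroCountRe_le_combined_of_Ivic1985_theorem11_3 h η hη
    exact ⟨C, B, T₀, h'⟩

end Literature.NumberTheory.LFunctions
end
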